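import Summits.AtomisticToContinuum.Crystallization.Theses.ReggeStarCoercivity
import Summits.AtomisticToContinuum.Crystallization.Theses.HullMinimality
import Summits.AtomisticToContinuum.Crystallization.Theorems.DefectFreeCrystallizes.Negative.PredicateAPI

/-!
# Line `prestress-split-korn` for crux `ReggeStarCoercivity.DefectFreeCrystallizes`
# (item stmt-AtomisticToContinuum-13603) — CHECKED SKELETON (crux-plan, round 1)

Crux (by name, concluded by `DefectFreeCrystallizes_of` below):
`Summit.AtomisticToContinuum.Crystallization.Theses.ReggeStarCoercivity.DefectFreeCrystallizes`
= `ZeroDefectDensity-for-every-ground-state-sequence → IsCrystallizing lennardJones 3`, the defect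
predicate being `PredicateAPI.Good` / `PredicateAPI.defects` VERBATIM (`defectFreeCrystallizes_iff` is
`Iff.rfl`, landed Negative lemma file of the standing disprover).

The line (idea card `Ideas/prestress-split-korn.md`, triage r1-1/2/3: pass, "one line with own-word-squeeze:
the split is the ENGINE of its step 4"):

  S1 `stub_tiltedWells`        one-variable calculus on V_LJ: tilted STRUT wells are single-welled with an explicit
                               modulus on the funnel window; tilted CABLE wells are flat-concave (explicit tax).
  S2 `stub_funnelRigidity`     potential-free NONLINEAR interior L²-rigidity of the Barlow contact frameworks
                               (free-height layered templates, any Hägg word) for deformations in the funnel: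
                               one isometry per half-ball, bond-vector deviations ≤ K · (true strut stretches)², K ≤ 16.
  S3 `stub_localTemplate`      potential-free robust LOCAL template: around a site all of whose 3R-neighbours are
                               crux-good, particles are labelled by the ideal layered template of some Hägg word, each unit
                               cluster 1/20-close to a similar copy (S2 consumes the looser 1/12, which survives
                               passing to the relaxed template of the same word).
  S4 `stub_splitCoercivity`    THE ENGINE (hardest): S1 → S2 → S3 → `SplitCoercivity` — site-energy coercivity on deep
                               crux-good regions Ω of δ-separated finite configurations, charging c(η) per site whose
                               2-ball is not η-layered, with boundary slack C·#∂_ρΩ and a mesoscopic slack θ·#Ω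
                               (prestress split about the relaxed stacking of the local word on balls of radius ρ(θ);
                               linear term = boundary FLUX by zero stress; cables dropped; struts by S1; transverse
                               strut term by S2; budget |ω₁|·K + τ < c'_min).
  S5 `stub_squeezeToLayered`   the SQUEEZE: `SplitCoercivity` → `LayeredOfZeroDefects` (per ground-state sequence:
                               crux antecedent ⇒ layered windows in the format of `HullMinimality.LayeredWindows`):
                               trial-state bound E(N) ≤ N e* + o(N), 1/3-separation, counting, c(η) vs θ → 0,
                               integration of overlapping local layered fits, compactness in a.
  S6 `stub_periodicGivenLayered`  = `HullMinimality.PeriodicGivenLayered` (stmt-11779) BY NAME (stacking selection;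
                               this is where exact minimality selects the stacking — the Disproof's gen-1 verdict).
  S7 `stub_hullCriterion`      = `HullMinimality.HullCriterion` (stmt-3243) BY NAME (provable-now hull glue).

`composition : S1 → S2 → S3 → S4 → S5 → S6 → S7 → (crux, unfolded once by PredicateAPI.defectFreeCrystallizes_iff)` is
pure logic (no sorry, no stub used); `DefectFreeCrystallizes_of : DefectFreeCrystallizes` concludes the crux BY NAME by
feeding the seven registered stubs into `composition` — it carries no sorry of its own (sorries live only inside `stub_*`)
and becomes the crux proof the moment the stubs land. (obligation-tag attributes are gate-reserved, hence the hypothesis-free form.)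
-/

noncomputable section

open scoped BigOperators Classical
open Filter Topology

namespace Summit.AtomisticToContinuum.Crystallization.Cruxes.DefectFreeCrystallizes.PrestressSplitKorn

open Summit.AtomisticToContinuum.Crystallization.Theses
open Summit.AtomisticToContinuum.Crystallization.Theses.ReggeStarCoercivity
open Summit.AtomisticToContinuum.Crystallization.Theorems.DefectFreeCrystallizes.Negative.PredicateAPI
open Literature.MathematicalPhysics.StatisticalMechanics Literature.Geometry.DiscreteGeometry

local notation "E3" => EuclideanSpace ℝ (Fin 3)

/-! ## Vocabulary (transparent abbreviations of expressions already used by the cone's items) -/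

/-- Site `(m, i, j)` of the LAYERED TEMPLATE with in-layer spacing `a`, Hägg word `s` and free layer
heights `z` — verbatim the generic element of the set `S` in `HullMinimality.LayeredWindows` (stmt-11778)
and in 11779 / 13958, written as a labelled map so that deformations can be indexed by labels. -/
def layeredPos (a : ℝ) (s : ℤ → ℤ) (z : ℤ → ℝ) (l : ℤ × ℤ × ℤ) : E3 :=
  ((l.2.1 : ℝ) • triangularVec₁ a) + ((l.2.2 : ℝ) • triangularVec₂ a) +
    ((haggLabel s l.1 : ℝ) • barlowOffset a) + (z l.1 • layerNormal 1)

/-- The ideal layer heights `m ↦ m·√(2/3)` (touching-ball stacking at `a = 1`; increments in the box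
`[39/50, 17/20]`). -/
def idealHeights (m : ℤ) : ℝ := (m : ℝ) * Real.sqrt (2 / 3)

/-- The relaxation box of the cone (route PoissonBesselStacking box B, used by 11778/11779/13958):
`a ∈ [47/50, 1]`, every interlayer increment in `[39a/50, 17a/20]`. -/
def InBox (a : ℝ) (z : ℤ → ℝ) : Prop :=
  47 / 50 ≤ a ∧ a ≤ 1 ∧ ∀ m : ℤ, 39 / 50 * a ≤ z (m + 1) - z m ∧ z (m + 1) - z m ≤ 17 / 20 * a

/-- Site energy `e_i = ½ Σ_{j ≠ i} V_LJ(|x_i − x_j|)` (as in PhononSlackCertificates.NearFieldConvexity). -/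
def siteEnergy {N : ℕ} (x : Fin N → E3) (i : Fin N) : ℝ :=
  (1 / 2 : ℝ) * ∑ j ∈ Finset.univ.erase i, lennardJones (dist (x i) (x j))

/-- `e* = ⨅` over periodic configurations of the Lennard-Jones energy per particle. -/
def ePer : ℝ :=
  ⨅ Q : PeriodicConfiguration 3, Q.energyPerParticle lennardJones

/-- The 2-ball of particle `i` is two-way `η`-matched, after a translation, to a rigid image of a layered
template in the box (verbatim the local predicate of PhononSlackCertificates.NearFieldConvexity, stmt-13958). -/
def LayeredNear {N : ℕ} (η : ℝ) (x : Fin N → E3) (i : Fin N) : Prop :=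
  ∃ (A : E3 →ₗᵢ[ℝ] E3) (t : E3) (a : ℝ) (s : ℤ → ℤ) (z : ℤ → ℝ), InBox a z ∧ IsHaggSeq s ∧
    let S : Set E3 := Set.range fun l : ℤ × ℤ × ℤ => A (layeredPos a s z l)
    (∀ j : Fin N, dist (x j) (x i) ≤ 2 → ∃ p ∈ S, dist (x j + t) p ≤ η) ∧
      (∀ p ∈ S, dist p (x i + t) ≤ 2 → ∃ j : Fin N, dist (x j + t) p ≤ η)

/-- FUNNEL CLOSENESS (tolerance `τ`) of a deformation `y` of the template `T` at label `l`: the unit cluster of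
`l` (template neighbours within `6/5`, i.e. exactly the twelve struts for every box template) is mapped
`τ·μ`-close, label by label, to a similar copy — scale `μ ∈ [17/20, 6/5]`, isometry `A ∈ O(3)`. With `τ = 1/20`
and the ideal template this is VERBATIM the crux's goodness of the site read through a labelling (S3 delivers it);
S2 consumes the looser `τ = 1/12`, which survives replacing the ideal template by the relaxed one of the same word. -/
def ClusterClose (τ : ℝ) (T y : ℤ × ℤ × ℤ → E3) (l : ℤ × ℤ × ℤ) : Prop :=
  ∃ (A : E3 →ₗᵢ[ℝ] E3) (μ : ℝ), 17 / 20 ≤ μ ∧ μ ≤ 6 / 5 ∧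
    ∀ l' : ℤ × ℤ × ℤ, dist (T l') (T l) ≤ 6 / 5 → dist (y l' - y l) (μ • A (T l' - T l)) ≤ τ * μ

/-! ## The five statement blocks of the line -/

/-- **S1 — tilted Lennard-Jones wells (calculus; numbers in the line card).** With the bond tension per
squared length `ω(r*) = V'(r*)/(2r*) = (r*⁻⁷ − r*⁻¹³)/(2r*)` of a reference bond of length `r*`, the tilted
well `Ṽ(r) = V(r) − ω(r*)·r²` satisfies: (a) STRUTS NEAR THE RELAXED REFERENCE (`r* ∈ [24/25, 49/50]`, the in-plane
and interlayer first-shell lengths 0.9714 / 0.9697 of the relaxed stackings): `Ṽ(r) − Ṽ(r*) ≥ (59/20)(r − r*)²` on the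
one-shell band `r ∈ [9/10, 21/20]` (numerical min 3.009 at `(r, r*) = (21/20, 49/50)`; 5.46 at `r = r* = 0.9714`) — the
clause the budget `|ω₁|·K + τ < c'` is read with (`|ω₁| ≤ 0.135`, `K ≤ 16` from S2: `2.95 > 2.16 + τ`);
(b) STRUTS ON THE WHOLE FUNNEL (`r* ∈ [19/20, 1]`, `r ∈ [4/5, 6/5]`): modulus `≥ 7/8` (min 0.9216 at `(6/5, 1)`) — single
welled with NO convexity radius, the large-distortion regime being priced with O(1) margins; (c) CABLES (`r* ≥ 6/5`,
`ω > 0`, concave tail): `Ṽ(r) − Ṽ(r*) ≥ −(11/2)·r*⁻⁸·(r − r*)²` for `|r − r*| ≤ r*/10` (numerical sup of the tax 5.195 —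
the pure `−r⁻⁶/6` limit at 10 % compression; 2.96 at the √2-shell). Numerics: planner folder calc/wells.py. -/
def TiltedWells : Prop :=
  (∀ rs r : ℝ, 24 / 25 ≤ rs → rs ≤ 49 / 50 → 9 / 10 ≤ r → r ≤ 21 / 20 →
      (59 / 20 : ℝ) * (r - rs) ^ 2 ≤
        lennardJones r - lennardJones rs - (rs⁻¹ ^ 7 - rs⁻¹ ^ 13) / (2 * rs) * (r ^ 2 - rs ^ 2)) ∧
  (∀ rs r : ℝ, 19 / 20 ≤ rs → rs ≤ 1 → 4 / 5 ≤ r → r ≤ 6 / 5 →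
      (7 / 8 : ℝ) * (r - rs) ^ 2 ≤
        lennardJones r - lennardJones rs - (rs⁻¹ ^ 7 - rs⁻¹ ^ 13) / (2 * rs) * (r ^ 2 - rs ^ 2)) ∧
  (∀ rs r : ℝ, 6 / 5 ≤ rs → |r - rs| ≤ rs / 10 →
      -(11 / 2 : ℝ) * rs⁻¹ ^ 8 * (r - rs) ^ 2 ≤
        lennardJones r - lennardJones rs - (rs⁻¹ ^ 7 - rs⁻¹ ^ 13) / (2 * rs) * (r ^ 2 - rs ^ 2))

/-- **S2 — nonlinear interior rigidity of the Barlow contact frameworks in the funnel (potential-free).**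
One constant `K ≤ 16` (the bet: twice the linear Bloch floor 8) for every box template `T = layeredPos a s z` (any Hägg
word, free heights): for every deformation `y` of the labels that is funnel-close (`ClusterClose (1/12)`) at every label
of the template ball
`B_R(c)`, `R ≥ 4`, there is ONE linear isometry `Q` with
`Σ_{struts in B_{R/2}(c)} ‖(y l' − y l) − Q(T l' − T l)‖² ≤ K · Σ_{struts in B_R(c)} (|y l' − y l| − |T l' − T l|)²`
(struts = template pairs at distance ≤ 6/5; true stretches on the right, no linearisation). Intended proof:
cellwise rigidity of the (near-regular) tetrahedra and octahedra of the template + a geometric-rigidity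
(Friesecke–James–Müller / F. John) estimate on their face-connected union, constant scale-invariant and
uniform in the word because only two cell shapes occur; the linear Bloch value `sup λ_max(L)/λ_min(A) = 8`
(fcc and hcp, Disproof numerics calc/korn.py) is the infinitesimal floor of `K`. -/
def FunnelRigidity : Prop :=
  ∃ K : ℝ, 0 < K ∧ K ≤ 16 ∧ ∀ (a : ℝ) (s : ℤ → ℤ) (z : ℤ → ℝ), InBox a z → IsHaggSeq s →
    ∀ (y : ℤ × ℤ × ℤ → E3) (c : E3) (R : ℝ), 4 ≤ R →
    ∀ (L Lh : Finset (ℤ × ℤ × ℤ)),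
      (∀ l, l ∈ L ↔ dist (layeredPos a s z l) c ≤ R) →
      (∀ l, l ∈ Lh ↔ dist (layeredPos a s z l) c ≤ R / 2) →
      (∀ l ∈ L, ClusterClose (1 / 12) (layeredPos a s z) y l) →
      ∃ Q : E3 →ₗᵢ[ℝ] E3,
        (∑ l ∈ Lh, ∑ l' ∈ Lh.filter (fun l' => l' ≠ l ∧ dist (layeredPos a s z l') (layeredPos a s z l) ≤ 6 / 5),
            ‖(y l' - y l) - Q (layeredPos a s z l' - layeredPos a s z l)‖ ^ 2) ≤
          K * ∑ l ∈ L, ∑ l' ∈ L.filter (fun l' => l' ≠ l ∧ dist (layeredPos a s z l') (layeredPos a s z l) ≤ 6 / 5),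
            (dist (y l') (y l) - dist (layeredPos a s z l') (layeredPos a s z l)) ^ 2

/-- **S3 — robust LOCAL template for the crux predicate (potential-free geometry).** If every particle within
`3R` of particle `i` of an injective finite configuration is crux-GOOD (`PredicateAPI.Good`: 6/5-shell
1/20-close to fcc/hcp at a scale in `[9/10, 11/10]`), then there are a Hägg word `s`, a centre `c` and a
deformation `y` of the IDEAL template `layeredPos 1 s idealHeights` such that: template labels in `B_R(c)` are
carried to particles, every particle within `R/2` of `x i` is such an image, and `y` is funnel-close on every
unit cluster of the template ball (the word is consistent on the ball because two non-parallel hcp-type sheets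
meeting `B_{6R/5}` would cross inside the good region `B_{3R}`; type of a good site is unambiguous by the landed
`Negative.TypeGap`). -/
def LocalTemplate : Prop :=
  ∀ (R : ℝ), 4 ≤ R → ∀ (N : ℕ) (x : Fin N → E3), Function.Injective x → ∀ i : Fin N,
    (∀ j : Fin N, dist (x j) (x i) ≤ 3 * R → Good x j) →
    ∃ (s : ℤ → ℤ) (c : E3) (y : ℤ × ℤ × ℤ → E3), IsHaggSeq s ∧
      (∀ l, dist (layeredPos 1 s idealHeights l) c ≤ R → ∃ j : Fin N, y l = x j) ∧
      (∀ j : Fin N, dist (x j) (x i) ≤ R / 2 → ∃ l, dist (layeredPos 1 s idealHeights l) c ≤ R ∧ y l = x j) ∧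
      Set.InjOn y {l | dist (layeredPos 1 s idealHeights l) c ≤ R} ∧
      (∀ l, dist (layeredPos 1 s idealHeights l) c ≤ R → ClusterClose (1 / 20) (layeredPos 1 s idealHeights) y l)

/-- **The coercivity interface delivered by the engine (S4) and consumed by the squeeze (S5).** For every
separation `δ` and tolerance `η` there is a charge `c > 0` (independent of `θ`!) such that for every mesoscopic
slack `θ > 0` there are a depth `ρ` and a boundary constant `C` with: for every `δ`-separated finite `x` and
every set `Ω` of particles whose `ρ`-neighbourhoods are entirely crux-good,
`c·#{i ∈ Ω : 2-ball not η-layered} − C·#{i ∈ Ω : within ρ of a particle outside Ω} − θ·#Ω ≤ Σ_{i∈Ω} (e_i − e*)`.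
Shape of PhononSlackCertificates.NearFieldConvexity (13958) for the crux's own predicate, weakened by the
`θ`-slack that the mesoscopic localisation of the split's boundary flux costs (see line card, Flux). -/
def SplitCoercivity : Prop :=
  ∀ δ : ℝ, 0 < δ → ∀ η : ℝ, 0 < η → ∃ c : ℝ, 0 < c ∧ ∀ θ : ℝ, 0 < θ → ∃ ρ C : ℝ, 0 < ρ ∧
    ∀ (N : ℕ) (x : Fin N → E3), (∀ i j : Fin N, i ≠ j → δ ≤ dist (x i) (x j)) →
    ∀ Ω : Finset (Fin N), (∀ i ∈ Ω, ∀ j : Fin N, dist (x j) (x i) ≤ ρ → Good x j) →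
      c * ((Ω.filter fun i => ¬ LayeredNear η x i).card : ℝ)
          - C * ((Ω.filter fun i => ∃ j : Fin N, j ∉ Ω ∧ dist (x j) (x i) ≤ ρ).card : ℝ)
          - θ * (Ω.card : ℝ)
        ≤ ∑ i ∈ Ω, (siteEnergy x i - ePer)

/-- **Output of the squeeze: layered windows for a defect-free sequence** — per ground-state sequence, the
crux's antecedent (with `PredicateAPI.defects`, verbatim the crux's count) implies the conclusion of
`HullMinimality.LayeredWindows` (stmt-11778) for that sequence, i.e. exactly the hypothesis of
`HullMinimality.PeriodicGivenLayered` (stmt-11779). (= card own-word-squeeze's `DefectFreeLayered`.) -/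
def LayeredOfZeroDefects : Prop :=
  ∀ x : (N : ℕ) → (Fin N → E3), (∀ N, IsGroundState lennardJones (x N)) →
    Tendsto (fun N : ℕ => (defects (x N) : ℝ) / N) atTop (𝓝 0) →
    ∃ a : ℝ, 47 / 50 ≤ a ∧ a ≤ 1 ∧ ∀ R ε : ℝ, 0 < ε → ∃ᶠ N in Filter.atTop,
      ∃ (A : E3 →ₗᵢ[ℝ] E3) (t : E3) (s : ℤ → ℤ) (z : ℤ → ℝ), IsHaggSeq s ∧
        (∀ m : ℤ, 39 / 50 * a ≤ z (m + 1) - z m ∧ z (m + 1) - z m ≤ 17 / 20 * a) ∧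
        let S : Set E3 := {p | ∃ m i j : ℤ, p = A (((i : ℝ) • triangularVec₁ a) +
          ((j : ℝ) • triangularVec₂ a) + ((haggLabel s m : ℝ) • barlowOffset a) + (z m • layerNormal 1))}
        (∀ p ∈ S, ‖p‖ ≤ R → ∃ i : Fin N, dist (x N i + t) p ≤ ε) ∧
          (∀ i : Fin N, ‖x N i + t‖ ≤ R → ∃ p ∈ S, dist (x N i + t) p ≤ ε)

/-- **S4 as a named obligation**: the engine's closure `TiltedWells → FunnelRigidity → LocalTemplate → SplitCoercivity`. -/
def SplitClosure : Prop :=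
  TiltedWells → FunnelRigidity → LocalTemplate → SplitCoercivity

/-- **S5 as a named obligation**: the squeeze `SplitCoercivity → LayeredOfZeroDefects`. -/
def SqueezeClosure : Prop :=
  SplitCoercivity → LayeredOfZeroDefects

/-! ## Registered stubs (the only sorries of the file) -/

/-- S1 (size M; provable now: monotonicity of `W'(s) = ½s⁻⁴(1 − s⁻³)` below `s = (7/4)^{1/3}`,
positivity above, and a one-variable modulus estimate on a compact window). Signature spelled out (it is
self-contained over `lennardJones`); `TiltedWells` is the same text (certified by the `example` below). -/
theorem stub_tiltedWells :
    (∀ rs r : ℝ, 24 / 25 ≤ rs → rs ≤ 49 / 50 → 9 / 10 ≤ r → r ≤ 21 / 20 →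
        (59 / 20 : ℝ) * (r - rs) ^ 2 ≤
          lennardJones r - lennardJones rs - (rs⁻¹ ^ 7 - rs⁻¹ ^ 13) / (2 * rs) * (r ^ 2 - rs ^ 2)) ∧
    (∀ rs r : ℝ, 19 / 20 ≤ rs → rs ≤ 1 → 4 / 5 ≤ r → r ≤ 6 / 5 →
        (7 / 8 : ℝ) * (r - rs) ^ 2 ≤
          lennardJones r - lennardJones rs - (rs⁻¹ ^ 7 - rs⁻¹ ^ 13) / (2 * rs) * (r ^ 2 - rs ^ 2)) ∧
    (∀ rs r : ℝ, 6 / 5 ≤ rs → |r - rs| ≤ rs / 10 →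
        -(11 / 2 : ℝ) * rs⁻¹ ^ 8 * (r - rs) ^ 2 ≤
          lennardJones r - lennardJones rs - (rs⁻¹ ^ 7 - rs⁻¹ ^ 13) / (2 * rs) * (r ^ 2 - rs ^ 2)) := by
  sorry

example : TiltedWells := stub_tiltedWells

/-- S2 (size L, potential-free; the constant `K` is what the line's budget spends: `|ω₁|·K + τ < c'_min`). -/
theorem stub_funnelRigidity : FunnelRigidity := by
  sorry

/-- S3 (size L, potential-free; local form of cascade item RobustBarlowTemplate stmt-12088 for the crux's predicate). -/
theorem stub_localTemplate : LocalTemplate := by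
  sorry

/-- S4 — THE ENGINE, hardest stub (size XL): the prestress split closes coercivity,
`TiltedWells → FunnelRigidity → LocalTemplate → SplitCoercivity`. -/
theorem stub_splitCoercivity : SplitClosure := by
  sorry

/-- S5 — the squeeze (size L; twin of PhononSlackCertificates.HullBridge stmt-13961 with the crux's antecedent
in place of the coercive two-shell gap; spends minimality through `E(N) ≤ N·e* + o(N)`):
`SplitCoercivity → LayeredOfZeroDefects`. -/
theorem stub_squeezeToLayered : SqueezeClosure := by
  sorry

/-- S6 = item stmt-11779 BY NAME (`HullMinimality.PeriodicGivenLayered`, size L, shared open crux: stacking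
selection inside the hull — where exact minimality selects the stacking, the Disproof's gen-1 verdict). -/
theorem stub_periodicGivenLayered : HullMinimality.PeriodicGivenLayered := by
  sorry

/-- S7 = item stmt-3243 BY NAME (`HullMinimality.HullCriterion`, provable-now, M in Lean). -/
theorem stub_hullCriterion : HullMinimality.HullCriterion := by
  sorry

/-! ## The kernel-checked composition -/

/-- **Pure logic of the line** (no sorry, no stub used): S1 → S2 → S3 → S4 → S5 → S6 → S7 → the crux, the latter
written unfolded once (`PredicateAPI.defectFreeCrystallizes_iff` is `Iff.rfl`) so that this documentation theorem is not
itself a by-name candidate. The crux's antecedent, read per sequence, feeds the squeeze; 11779 turns layered windows into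
periodic windows; 3243 is the hull criterion. -/
theorem composition :
    TiltedWells → FunnelRigidity → LocalTemplate → SplitClosure → SqueezeClosure →
    HullMinimality.PeriodicGivenLayered → HullMinimality.HullCriterion →
    ((∀ x : (N : ℕ) → (Fin N → E3), (∀ N, IsGroundState lennardJones (x N)) →
        Tendsto (fun N : ℕ => (defects (x N) : ℝ) / N) atTop (𝓝 0)) →
      IsCrystallizing lennardJones 3) := by
  intro h₁ h₂ h₃ h₄ h₅ h₆ h₇ hZ
  have hL : LayeredOfZeroDefects := h₅ (h₄ h₁ h₂ h₃)
  exact h₇ fun x hx => h₆ x hx (hL x hx (hZ x hx))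

/-- **The line concludes the crux BY NAME.** The seven registered stubs fed into `composition`; no sorry of its own. -/
theorem DefectFreeCrystallizes_of :
    Summit.AtomisticToContinuum.Crystallization.Theses.ReggeStarCoercivity.DefectFreeCrystallizes := by
  rw [defectFreeCrystallizes_iff]
  exact composition stub_tiltedWells stub_funnelRigidity stub_localTemplate stub_splitCoercivity
    stub_squeezeToLayered stub_periodicGivenLayered stub_hullCriterion

end Summit.AtomisticToContinuum.Crystallization.Cruxes.DefectFreeCrystallizes.PrestressSplitKorn

end
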